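import Literature.MathematicalPhysics.KineticTheory.KickMatchedSwapRestart
import Literature.Analysis.FluidPDE.HardSphereTorusMeasure
import HarnessLib

/-!
# The admissible normals at a simple binary contact have positive flux measure

Topic `Literature/MathematicalPhysics/KineticTheory`. For the kick-matched hard-sphere gas `Z*` of
`KickMatchedHardSphereGas` (crux line `stein-lindeberg-kick-swap` of
`InformationPercolationEngine.PercolationClosesChaos`, stmt-AtomisticToContinuum-13914, stub S3a `SwapIdentity`,
node B0 of its lemma DAG): at a SIMPLE incoming binary contact `y` of the pair `p = (i, j)` on `𝕋³` (diameter
`ε = hsDiameter σ N ∈ (0, 1/2)`), the set of ADMISSIBLE kicks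
`A = {ω ∈ 𝕊² | IsAdmissible σ N i j ω y}` (unit, incoming hemisphere, re-placed partner overlaps nobody) contains a
neighbourhood in `𝕊²` of the true impact vector `ω₀ = ε⁻¹(x_i − x_j)`, on which the flux density `((w − v)·ω)₊` is
positive; hence the restricted reference flux law of the swap (`restrictedMean`) is a genuine normalised mean:
`fluxLaw v_i v_j A ≠ 0` (`fluxLaw_setOf_isAdmissible_ne_zero`). Ingredients: the positions of the kicked
configuration (`kickAt_apply_fst`), the minimal-image distance of a point of `𝕋³` to its own translate
(`norm_sepVec_translate_neg_smul`), continuity of the torus geometry (`Torus.isHardSphereRegular_geometry`), binary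
contact (`Alexander.IsSimpleIncomingWith`: every other gap is `> ε`), and `IsOpenPosMeasure` of the surface measure
(`Measure.toSphere`).

References: F. Comets, S. Popov, G. M. Schütz, M. Vachkovskaia, *Billiards in a general domain with random
reflections*, ARMA 191 (2008), §2.2 (the cosine reflection law has full support on the inward hemisphere)
[CometsEtAl2008]; C. Cercignani, R. Illner, M. Pulvirenti, *The Mathematical Theory of Dilute Gases* (1994), §4.2
(binary, non-grazing collisions are the generic ones) [CIP1994].
-/

noncomputable section

open scoped BigOperators ENNReal Topology RealInnerProductSpace
open MeasureTheory Set Filter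
open Literature.Analysis.FluidPDE

namespace Literature.MathematicalPhysics.KineticTheory.KickMatchedHardSphereGas

variable {σ : ℝ} {N : ℕ}

/-- **Positions of the kicked configuration**: kicking the pair `(i, j)` of `y` with `ω` moves the partner `j` to
`x_i − ε ω` and nobody else (`collidePair` only changes velocities). [folklore] -/
theorem kickAt_apply_fst (i j : Fin (N + 1)) (ω : V3) (y : Cfg N) (m : Fin (N + 1)) :
    ((kickAt σ N i j ω y) m).1 =
      if m = j then geo.translate (y i).1 (-(hsDiameter σ N • ω)) else (y m).1 := by
  unfold kickAt
  rw [collidePair_apply_fst, Function.update_apply]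
  split_ifs <;> rfl

/-- A point of `𝕋³` is at minimal-image separation `0` from itself. [folklore] -/
theorem sepVec_self (x : T3) : geo.sepVec x x = 0 := by
  rw [Torus.geometry_sepVec, sub_self, Torus.reprSym_zero]

/-- **The re-placed partner is at distance exactly `ε`**: for `0 ≤ ε < 1/2` and a unit vector `ω`, the minimal-image
separation of `x` and `x − ε ω` on `𝕋³` has norm `ε`, in both orders. [folklore] -/
theorem norm_sepVec_translate_neg_smul {ε : ℝ} (hε : 0 ≤ ε) (hε2 : ε < 2⁻¹) (x : T3) {ω : V3} (hω : ‖ω‖ = 1) :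
    ‖geo.sepVec x (geo.translate x (-(ε • ω)))‖ = ε ∧ ‖geo.sepVec (geo.translate x (-(ε • ω))) x‖ = ε := by
  have hn : ‖ε • ω‖ = ε := by rw [norm_smul, Real.norm_eq_abs, abs_of_nonneg hε, hω, mul_one]
  have hε2' : ε < 1 / 2 := by rw [one_div]; exact hε2
  constructor
  · have h := Torus.sepVec_translate_of_norm_lt (d := Fin 3) (x := x) (y := x) (a := 0) (b := -(ε • ω))
      (by rw [sepVec_self, norm_zero, zero_add, zero_sub, neg_neg, hn]; exact hε2')
    rw [Geometry.translate_zero] at h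
    rw [h, sepVec_self, zero_add, zero_sub, neg_neg, hn]
  · have h := Torus.sepVec_translate_of_norm_lt (d := Fin 3) (x := x) (y := x) (a := -(ε • ω)) (b := 0)
      (by rw [sepVec_self, norm_zero, zero_add, sub_zero, norm_neg, hn]; exact hε2')
    rw [Geometry.translate_zero] at h
    rw [h, sepVec_self, zero_add, sub_zero, norm_neg, hn]

/-- The flux density `((w − v)·ω)₊` is a continuous function on the sphere. [folklore] -/
theorem continuous_hardSphereKernel_sphere (w v : V3) :
    Continuous fun ω : Metric.sphere (0 : V3) 1 => hardSphereKernel (w, v) ω := by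
  unfold hardSphereKernel
  exact (continuous_const.inner continuous_subtype_val).max continuous_const

/-- **A flux law charges every open set of the sphere meeting its open hemisphere**: if `O ⊆ ℝ³` is open, contains
a unit vector, and `(w − v)·ω > 0` on `O`, then `fluxLaw v w (O ∩ 𝕊²) ≠ 0` (the surface measure is positive on
nonempty open sets and the density `((w − v)·ω)₊` is positive there). [folklore] -/
theorem fluxLaw_preimage_ne_zero_of_isOpen {v w : V3} {O : Set V3} (hO : IsOpen O)
    (hpos : ∀ ω ∈ O, 0 < ⟪w - v, ω⟫) {ω₀ : V3} (hω₀ : ω₀ ∈ O) (hω₀1 : ‖ω₀‖ = 1) :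
    fluxLaw v w ((Subtype.val : Metric.sphere (0 : V3) 1 → V3) ⁻¹' O) ≠ 0 := by
  set U : Set (Metric.sphere (0 : V3) 1) := Subtype.val ⁻¹' O with hU
  have hUopen : IsOpen U := hO.preimage continuous_subtype_val
  have hω₀S : ω₀ ∈ Metric.sphere (0 : V3) 1 := mem_sphere_zero_iff_norm.2 hω₀1
  have hUne : U.Nonempty := ⟨⟨ω₀, hω₀S⟩, hω₀⟩
  haveI : (sphereMeasure : Measure (Metric.sphere (0 : V3) 1)).IsOpenPosMeasure := by
    unfold sphereMeasure; infer_instance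
  have hUpos : sphereMeasure U ≠ 0 := hUopen.measure_ne_zero sphereMeasure hUne
  intro h0
  have h0' : ∫⁻ ω in U, ENNReal.ofReal (hardSphereKernel (w, v) ω) ∂sphereMeasure = 0 := by
    rw [← withDensity_apply _ hUopen.measurableSet]; exact h0
  have hmeas : Measurable fun ω : Metric.sphere (0 : V3) 1 => ENNReal.ofReal (hardSphereKernel (w, v) ω) :=
    (continuous_hardSphereKernel_sphere w v).measurable.ennreal_ofReal
  have hae := (lintegral_eq_zero_iff hmeas).1 h0'
  have h1 : ∀ᵐ ω ∂(sphereMeasure.restrict U), ω ∉ U := by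
    filter_upwards [hae] with ω hω hωU
    have hk : 0 < hardSphereKernel (w, v) ω := by
      unfold hardSphereKernel
      exact lt_max_of_lt_left (hpos _ hωU)
    have hω' : ENNReal.ofReal (hardSphereKernel (w, v) ω) = 0 := hω
    rw [ENNReal.ofReal_eq_zero] at hω'
    exact (not_le.2 hk) hω'
  have h2 : (sphereMeasure.restrict U) U = 0 := by
    have h := ae_iff.1 h1
    simpa only [not_not, setOf_mem_eq] using h
  rw [Measure.restrict_apply_self] at h2
  exact hUpos h2

/-- **The admissible kicks contain a neighbourhood of the true impact vector.** For `0 < ε = hsDiameter σ N < 1/2`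
and a simple incoming collision configuration `y` with colliding pair `(i, j)` there is an open `O ⊆ ℝ³` containing
`ω₀ = ε⁻¹ sep(x_i, x_j)`, on which `(v_j − v_i)·ω > 0`, all of whose UNIT vectors are admissible kicks: every gap of
the partner `j` to a third sphere is `> ε` (binary contact), so by continuity of the torus geometry all `ω` near
`ω₀` keep the re-placed partner `x_i − ε ω` overlap-free (its distance to `x_i` is exactly `ε`). [folklore] -/
theorem exists_isOpen_isAdmissible (hε : 0 < hsDiameter σ N) (hε2 : hsDiameter σ N < 2⁻¹) {y : Cfg N}
    {p : Fin (N + 1) × Fin (N + 1)} (hp : Alexander.IsSimpleIncomingWith geo (hsDiameter σ N) y p) :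
    ∃ O : Set V3, IsOpen O ∧ (hsDiameter σ N)⁻¹ • geo.sepVec (y p.1).1 (y p.2).1 ∈ O ∧
      (∀ ω ∈ O, 0 < ⟪(y p.2).2 - (y p.1).2, ω⟫) ∧ ∀ ω ∈ O, ‖ω‖ = 1 → IsAdmissible σ N p.1 p.2 ω y := by
  have hG := Torus.isHardSphereRegular_geometry (d := Fin 3) hε2
  obtain ⟨i, j⟩ := p
  dsimp only at hp ⊢
  have hij : i ≠ j := hp.ne
  have hc : y ∈ contactSet geo (N + 1) (hsDiameter σ N) i j := hp.mem_contactSet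
  have hydom : y ∈ hardSphereDomain geo (N + 1) (hsDiameter σ N) := hp.mem_hardSphereDomain
  have hdom : ∀ a b, a ≠ b → hsDiameter σ N ≤ ‖geo.sepVec (y a).1 (y b).1‖ := mem_hardSphereDomain.1 hydom
  have hadm : IsAdmissible σ N i j ((hsDiameter σ N)⁻¹ • geo.sepVec (y i).1 (y j).1) y :=
    isAdmissible_inv_smul_sepVec hε hc hp.isIncoming
  -- the re-placement map and its value at the true impact vector
  obtain ⟨T, hT⟩ : ∃ T : V3 → T3, ∀ ω, T ω = geo.translate (y i).1 (-(hsDiameter σ N • ω)) := ⟨_, fun _ => rfl⟩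
  have hTω₀ : T ((hsDiameter σ N)⁻¹ • geo.sepVec (y i).1 (y j).1) = (y j).1 := by
    have h := kickAt_apply_fst (σ := σ) i j ((hsDiameter σ N)⁻¹ • geo.sepVec (y i).1 (y j).1) y j
    rw [if_pos rfl, kickAt_inv_smul_sepVec hε.ne', collidePair_apply_fst, ← hT] at h
    exact h.symm
  -- every gap from the partner to a third sphere is `> ε`
  have hgap : ∀ l, l ≠ i → l ≠ j →
      hsDiameter σ N < ‖geo.sepVec (y l).1 (y j).1‖ ∧ hsDiameter σ N < ‖geo.sepVec (y j).1 (y l).1‖ := by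
    intro l hli hlj
    have h1 : y ∉ contactSet geo (N + 1) (hsDiameter σ N) l j := fun hc' => by
      rcases Alexander.finsetPair_eq_iff.1 ((hp.2.2 l j hlj).1 hc') with ⟨h, -⟩ | ⟨h, -⟩
      · exact hli h
      · exact hlj h
    have h2 : y ∉ contactSet geo (N + 1) (hsDiameter σ N) j l := fun hc' => by
      rcases Alexander.finsetPair_eq_iff.1 ((hp.2.2 j l (Ne.symm hlj)).1 hc') with ⟨-, h⟩ | ⟨-, h⟩
      · exact hlj h
      · exact hli h
    exact ⟨lt_of_le_of_ne (hdom l j hlj) fun he => h1 (mem_contactSet.2 ⟨hydom, he.symm⟩),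
      lt_of_le_of_ne (hdom j l (Ne.symm hlj)) fun he => h2 (mem_contactSet.2 ⟨hydom, he.symm⟩)⟩
  -- continuity of the gaps as functions of the kick
  have hTc : Continuous T := by
    have h1 : Continuous fun ω : V3 => ((y i).1, -(hsDiameter σ N • ω)) := by fun_prop
    have h := hG.continuous_translate.comp h1
    rw [show T = fun ω => geo.translate (y i).1 (-(hsDiameter σ N • ω)) from funext hT]
    simpa only [Function.comp_def] using h
  have hf : ∀ l, Continuous fun ω : V3 => ‖geo.sepVec (y l).1 (T ω)‖ := fun l => by
    have h1 : Continuous fun ω : V3 => ((y l).1, T ω) := continuous_const.prodMk hTc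
    have h := hG.continuous_norm_sepVec.comp h1
    simpa only [Function.comp_def] using h
  have hg : ∀ l, Continuous fun ω : V3 => ‖geo.sepVec (T ω) (y l).1‖ := fun l => by
    have h1 : Continuous fun ω : V3 => (T ω, (y l).1) := hTc.prodMk continuous_const
    have h := hG.continuous_norm_sepVec.comp h1
    simpa only [Function.comp_def] using h
  -- the open set of good directions
  set L : Finset (Fin (N + 1)) := Finset.univ.filter fun l => l ≠ i ∧ l ≠ j with hL
  refine ⟨{ω | 0 < ⟪(y j).2 - (y i).2, ω⟫} ∩ ⋂ l ∈ L,
    ({ω | hsDiameter σ N < ‖geo.sepVec (y l).1 (T ω)‖} ∩ {ω | hsDiameter σ N < ‖geo.sepVec (T ω) (y l).1‖}),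
    ?_, ?_, fun ω hω => hω.1, ?_⟩
  · refine (isOpen_lt continuous_const (continuous_const.inner continuous_id)).inter
      (isOpen_biInter_finset fun l _ => ?_)
    exact (isOpen_lt continuous_const (hf l)).inter (isOpen_lt continuous_const (hg l))
  · refine ⟨hadm.2.1, mem_iInter₂.2 fun l hl => ?_⟩
    obtain ⟨-, hli, hlj⟩ := Finset.mem_filter.1 hl
    refine ⟨?_, ?_⟩
    · show hsDiameter σ N < ‖geo.sepVec (y l).1 (T _)‖
      rw [hTω₀]; exact (hgap l hli hlj).1
    · show hsDiameter σ N < ‖geo.sepVec (T _) (y l).1‖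
      rw [hTω₀]; exact (hgap l hli hlj).2
  · intro ω hω hω1
    obtain ⟨hωpos, hωL⟩ := hω
    have hlt : ∀ l, l ≠ i → l ≠ j →
        hsDiameter σ N < ‖geo.sepVec (y l).1 (T ω)‖ ∧ hsDiameter σ N < ‖geo.sepVec (T ω) (y l).1‖ :=
      fun l hli hlj => (mem_iInter₂.1 hωL) l (Finset.mem_filter.2 ⟨Finset.mem_univ _, hli, hlj⟩)
    have hpair := norm_sepVec_translate_neg_smul hε.le hε2 (y i).1 hω1
    rw [← hT] at hpair
    refine ⟨hω1, hωpos, mem_hardSphereDomain.2 fun a b hab => ?_⟩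
    rw [kickAt_apply_fst, kickAt_apply_fst, ← hT]
    by_cases ha : a = j <;> by_cases hb : b = j
    · exact absurd (ha.trans hb.symm) hab
    · rw [if_pos ha, if_neg hb]
      by_cases hbi : b = i
      · rw [hbi, hpair.2]
      · exact (hlt b hbi hb).2.le
    · rw [if_neg ha, if_pos hb]
      by_cases hai : a = i
      · rw [hai, hpair.1]
      · exact (hlt a hai ha).1.le
    · rw [if_neg ha, if_neg hb]
      exact hdom a b hab

/-- **At a simple incoming binary contact the admissible kicks have positive flux measure.** For
`0 < ε = hsDiameter σ N < 1/2` and a simple incoming collision configuration `y` with colliding pair `p = (i, j)`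
(`Alexander.IsSimpleIncomingWith`: `(i, j)` in contact and incoming, no other pair in contact), the flux law of the
pair charges the admissible set: `fluxLaw v_i v_j {ω | IsAdmissible σ N i j ω y} ≠ 0` — so the restricted reference
mean `restrictedMean` of the swap is a genuine normalised average and the rejection sampler `kmNormal` succeeds
almost surely. [folklore] -/
theorem fluxLaw_setOf_isAdmissible_ne_zero (hε : 0 < hsDiameter σ N) (hε2 : hsDiameter σ N < 2⁻¹) {y : Cfg N}
    {p : Fin (N + 1) × Fin (N + 1)} (hp : Alexander.IsSimpleIncomingWith geo (hsDiameter σ N) y p) :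
    fluxLaw (y p.1).2 (y p.2).2
      {ω : Metric.sphere (0 : V3) 1 | IsAdmissible σ N p.1 p.2 (ω : V3) y} ≠ 0 := by
  obtain ⟨O, hO, hω₀, hpos, hadm⟩ := exists_isOpen_isAdmissible hε hε2 hp
  have hω₀1 : ‖(hsDiameter σ N)⁻¹ • geo.sepVec (y p.1).1 (y p.2).1‖ = 1 :=
    (isAdmissible_inv_smul_sepVec hε hp.mem_contactSet hp.isIncoming).1
  have hne := fluxLaw_preimage_ne_zero_of_isOpen hO hpos hω₀ hω₀1
  intro h0
  refine hne (measure_mono_null (fun ω hω => ?_) h0)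
  exact hadm ω hω (mem_sphere_zero_iff_norm.1 ω.2)

end Literature.MathematicalPhysics.KineticTheory.KickMatchedHardSphereGas

end
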